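import Summits.BirchSwinnertonDyer.Rank1Residual.X10.CoreTheoremAOddPrimeHolds
import Summits.BirchSwinnertonDyer.Rank1Residual.X10.LeafDischargeX10bHoward
import Summits.BirchSwinnertonDyer.BirchSwinnertonDyer.Theorems.GreenbergAnalyticMuZeroThreeOrdinaryIrreducible
import HarnessLib

/-!
# Class X10b (rung W-ALL/10): the leaf kernels with Greenberg's ANALYTIC `μ₃ = 0` binder `hA` DISCHARGED, and
# the ALGEBRAIC `μ₃ = 0` on the non-surjective irreducible ordinary locus modulo Kato's construction fact F1 alone

Cell `bsd-f3-mu`, width seat p1-w3 (`--supports stmt-BirchSwinnertonDyer-20682`, helper).  Theorems only; no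
definition, no named fact introduced, no `sorry`; no route file imported.

WHAT CHANGED.  The class node `X10.AnalyticMuZeroOnClassX10b` (Greenberg's analytic `μ = 0` at `3` on class X10b —
barrier B3 at `3`, displayed as the hypothesis `hA` by every leaf kernel of `Rank1Residual/X10/`) is now a THEOREM of
the tree with no input: crux stmt-BirchSwinnertonDyer-20682 closed `proved` by p576451 (LINE `theoremB-x10b`:
Vaserstein over `ℤ[1/m]` ⟹ THEOREM B ⟹ AN-9 ⟹ unit measure value ⟹ unit coefficient), and class-free as
`AnalyticMuZeroThree.muAnZeroAt_three` (`GreenbergAnalyticMuZeroThreeOrdinaryIrreducible.lean`, p577975).  This file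
feeds that theorem into the leaf kernels BY NAME, so that the displayed input lists of rung W-ALL/10 lose `hA`:

* `analyticMuZeroOnClassX10b_holds : AnalyticMuZeroOnClassX10b` — the node itself, route-file-free term.
* `muAlg_eq_zero_three_of_fine` — **Greenberg's `μ`-conjecture (LNM 1716 Conj. 1.11, the ALGEBRAIC `μ`) at `p = 3` on the
  locus «good ordinary at `3`, `E[3]` irreducible, `ρ̄_{E,3}` NOT surjective», modulo ONE published construction fact**
  F1 = `Kato2004.exists_divisibilityInputs_fineQuotient_zeta` (Kato Thm. 12.6 with (14.9.3)/§17.13): for every such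
  `E = W`, every newform `f` of `E` and every cyclotomic datum, `μ(X(E/ℚ_∞)) = 0` (`D.mu = 0`).  = N2's
  `mu_eq_zero_of_fine` (cell b2b-bsdres, Core Theorem A at odd `p`, PROVED) with its unit-coefficient hypothesis
  discharged by `muAnZeroAt_three`.  `muAlg_eq_zero_onClassX10b_of_fine` — the same on class X10b.
* `mazurMainConjectureOnClassX10b_of_fine'` / `…_of_fine_of_mazur'` — Mazur's integral cyclotomic main conjecture at
  `3` on class X10b (`X10.MazurMainConjectureOnClassX10b`, missing input X_A3 of row A5) modulo PUBLISHED inputs only: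
  Yan–Zhu 2026 Thm. 4.9 (`hYZ`, flag `YZ26@3-BF-ERL-Ohta`), the period-unit facts (`h5`, `h3`; or Mazur 1978 Cor. 4.1
  `hM`), modularity data (`hmodP`) and F1 (`hfine`) — `hA` GONE.
* `bsdpOnClassX10b_of_fine'` / `bsdpOnClassX10b_of_fine_of_mazur'` — the A5 class leaf `X10.BSDpOnClassX10b` (Miller's
  `BSD(E,3)` at every X10b pair) modulo the published binders, F1 and the rank-`1` Schneider rider `hC3` — `hA` GONE.
* `X10.bsdpOnClassX10b_of_heegnerFrameSupply_of_cor46_of_fine'` — the Howard/Heegner road (§3 of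
  `LeafDischargeX10bHoward`) modulo its print heads, the frame supply `hFS₃` — `hA` GONE.

HONEST FRAMING.  Every theorem here except `analyticMuZeroOnClassX10b_holds` stays CONDITIONAL on the displayed
published facts (and `hC3` / `hFS₃` where shown); nothing is booked; BSD is not proved by any of this.  What is new is
only that Greenberg's analytic `μ₃ = 0` is no longer among the inputs of rung W-ALL/10, and that the algebraic `μ₃ = 0`
on the X10b locus now rests on F1 alone.  References: [GreenbergLNM1716] Conj. 1.11, Thm. 4.1; [Kato2004Asterisque]
Thm. 12.6, §17.13; [YanZhu2024MainConjNonCM] Thm. 4.9; [Mazur1978] Cor. 4.1; [Miller2011LMS] Def. 1.1;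
[MastellaZerman2026] Cor. 4.6; [MazurTateTeitelbaum1986Invent] §I.10, §I.13; [Vaserstein1972SL2].
-/

set_option autoImplicit false

noncomputable section

open scoped Classical MatrixGroups ModularForm NumberField
open CongruenceSubgroup WeierstrassCurve Field IsDedekindDomain
open Literature.NumberTheory.GaloisRepresentations
open Literature.NumberTheory.GaloisCohomology
open Literature.NumberTheory.EllipticCurves Literature.NumberTheory.EllipticCurves.ModularForms
open Literature.NumberTheory.EllipticCurves.Kato2004
open Literature.NumberTheory.EllipticCurves.Kato2004.EulerSystemValues
open Literature.NumberTheory.EllipticCurves.Rank1Residual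
open Summit.BirchSwinnertonDyer.BirchSwinnertonDyer.Theorems.Rank1ResidualX1Defs
open Summit.BirchSwinnertonDyer.BirchSwinnertonDyer.Rank1Residual.AnalyticMuZeroThree

namespace Summit.BirchSwinnertonDyer.Rank1Residual.X10

/-! ### §1 The node `AnalyticMuZeroOnClassX10b` holds -/

/-- **`X10.AnalyticMuZeroOnClassX10b` HOLDS** (Greenberg's analytic `μ = 0` at `3` on class X10b; the definiens of
route PrintX10b's crux stmt-BirchSwinnertonDyer-20682, closed `proved` by p576451): for every X10b pair `(W, p)` and
every newform `f` of `W`, some coefficient of `L_3(f, α_W)` is a `3`-adic unit.  Route-file-free term: the class-free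
theorem `AnalyticMuZeroThree.muAnZeroAt_of_classX10` (input-free; `¬ Surj W 3` is not used).
[cite: GreenbergLNM1716, §1 Conj. 1.11 (p. 58)] [cite: MazurTateTeitelbaum1986Invent, §I.13] -/
theorem analyticMuZeroOnClassX10b_holds : AnalyticMuZeroOnClassX10b :=
  fun W _ _ p _ _ _ f hX _ hf => muAnZeroAt_of_classX10 W p hX f hf

/-! ### §2 The ALGEBRAIC `μ = 0` at `3` on the non-surjective irreducible ordinary locus, modulo F1 alone -/

/-- **Greenberg's `μ`-conjecture (algebraic `μ`, LNM 1716 Conj. 1.11) at `p = 3` for good ordinary `E/ℚ` with `E[3]`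
irreducible and `ρ̄_{E,3}` NOT surjective — modulo ONE published construction fact F1** (`hfine`: Kato Thm. 12.6 with
(14.9.3)/§17.13, the `Λ`-adic zeta class with the fine-quotient divisibility package): for every such `E = W` (globally
minimal), every newform `f` of `E`, the cyclotomic `ℤ₃`-extension `κ` with topological generator `γ` (a cyclotomic
variable) and every Pontryagin-dual Selmer datum `D` of `Sel_{3^∞}(E/ℚ_∞)`: `μ(X(E/ℚ_∞)) = 0` (`D.mu = 0`).  Proof: N2's
`mu_eq_zero_of_fine` (cell b2b-bsdres: Core Theorem A at odd `p` PROVED, Kato's `(c,d)`-integral class non-zero mod `3`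
once ONE coefficient of `L_3(f, α)` is a unit) with the unit coefficient supplied INPUT-FREE by
`AnalyticMuZeroThree.muAnZeroAt_three` (THEOREM B road).  The newform binder `f` stands in for modularity.
[cite: GreenbergLNM1716, §1 Conj. 1.11 (p. 58)] [cite: Kato2004Asterisque, Thm. 12.6 (p. 222), (14.9.3) (p. 240) and §17.13 (pp. 279–280)]
[cite: GreenbergVatsal2000, Prop. 3.7] -/
theorem muAlg_eq_zero_three_of_fine (hfine : exists_divisibilityInputs_fineQuotient_zeta) :
    ∀ (W : WeierstrassCurve ℚ) [W.IsElliptic] [W.IsGloballyMinimal] {N : ℕ} [NeZero N]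
      (f : CuspForm (Gamma0 N) 2),
      IsOrdinaryAt W 3 → W.HasIrreducibleModPGaloisRep 3 → ¬ W.HasSurjectiveModNGaloisRep 3 →
      IsNewformOf W f →
      ∀ (κ : ZpExtension ℚ 3) (γ : absoluteGaloisGroup ℚ),
        κ.IsCyclotomic → κ.IsTopGenerator γ → IsCyclotomicVariable 3 γ →
        ∀ D : W.SelmerDualData κ γ, D.mu = 0 :=
  fun W _ _ _ _ f hord hirr hns hf κ γ hκ hγ hγ' D =>
    mu_eq_zero_of_fine hfine W 3 f (by decide) hord.1 hord.2 hirr hns hf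
      (muAnZeroAt_three W hord hirr f hf) κ γ hκ hγ hγ' D

/-- **The same on class X10b**: for every X10b pair `(W, p)` (`ClassX10 W p`, `¬ Surj W 3`; so `p = 3`), every newform
`f` of `W` and every cyclotomic datum, `μ(X(E/ℚ_∞)) = 0` — modulo F1 alone.
[cite: GreenbergLNM1716, §1 Conj. 1.11 (p. 58)] [cite: Kato2004Asterisque, Thm. 12.6 (p. 222) and §17.13 (pp. 279–280)] -/
theorem muAlg_eq_zero_onClassX10b_of_fine (hfine : exists_divisibilityInputs_fineQuotient_zeta) :
    ∀ (W : WeierstrassCurve ℚ) [W.IsElliptic] [W.IsGloballyMinimal] (p : ℕ) [Fact p.Prime]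
      {N : ℕ} [NeZero N] (f : CuspForm (Gamma0 N) 2),
      ClassX10 W p → ¬ Surj W 3 → IsNewformOf W f →
      ∀ (κ : ZpExtension ℚ p) (γ : absoluteGaloisGroup ℚ),
        κ.IsCyclotomic → κ.IsTopGenerator γ → IsCyclotomicVariable p γ →
        ∀ D : W.SelmerDualData κ γ, D.mu = 0 := by
  intro W _ _ p _ N _ f hX hns hf κ γ hκ hγ hγ' D
  obtain ⟨rfl, hgo, hirr, -⟩ := id hX
  exact mu_eq_zero_of_fine hfine W 3 f (by decide) hgo.1 hgo.2 hirr hns hf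
    (muAnZeroAt_of_classX10 W 3 hX f hf) κ γ hκ hγ hγ' D

/-! ### §3 Rung W-ALL/10 kernels with `hA` discharged -/

/-- **X_A3 on class X10b modulo PUBLISHED inputs and F1 only — `hA` discharged** (`mazurMainConjectureOnClassX10b_of_fine`
with Greenberg's analytic `μ₃ = 0` supplied by the tree): Yan–Zhu 2026 Thm. 4.9 (`hYZ`, flag `YZ26@3-BF-ERL-Ohta`), the
period-unit facts `h5`/`h3`, modularity data `hmodP`, Kato's F1 `hfine` ⟹ Mazur's integral cyclotomic main conjecture at
`3` at every X10b pair.  CONDITIONAL on the displayed facts; nothing booked.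
[cite: YanZhu2024MainConjNonCM, Thm. 4.9 (§4.4)] [cite: Kato2004Asterisque, Thm. 12.6 (p. 222) and §17.13 (pp. 279–280)]
[cite: GreenbergLNM1716, §1 Conj. 1.11 (p. 58)] -/
theorem mazurMainConjectureOnClassX10b_of_fine'
    (hYZ : YanZhu2026.thm49_charIdeal_eq_padicLFunction)
    (h5 : realPeriodRat_eq_unit_mul_plusPeriod) (h3 : realPeriodRat_eq_unit_mul_plusPeriod_three)
    (hmodP : nonempty_modularParametrizationData)
    (hfine : exists_divisibilityInputs_fineQuotient_zeta) : MazurMainConjectureOnClassX10b :=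
  mazurMainConjectureOnClassX10b_of_fine hYZ h5 h3 hmodP hfine analyticMuZeroOnClassX10b_holds

/-- **X_A3 on class X10b with the period units sourced to Mazur 1978 Cor. 4.1 (`hM`) — `hA` discharged**: Yan–Zhu 4.9,
Mazur's odd Manin constant, modularity data, F1 ⟹ `X10.MazurMainConjectureOnClassX10b`.  CONDITIONAL; nothing booked.
[cite: YanZhu2024MainConjNonCM, Thm. 4.9 (§4.4)] [cite: Mazur1978, Cor. 4.1]
[cite: Kato2004Asterisque, Thm. 12.6 (p. 222) and §17.13 (pp. 279–280)] -/
theorem mazurMainConjectureOnClassX10b_of_fine_of_mazur'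
    (hYZ : YanZhu2026.thm49_charIdeal_eq_padicLFunction) (hM : mazur_not_dvd_maninConstant_of_odd)
    (hmodP : nonempty_modularParametrizationData)
    (hfine : exists_divisibilityInputs_fineQuotient_zeta) : MazurMainConjectureOnClassX10b :=
  mazurMainConjectureOnClassX10b_of_fine' hYZ (SkinnerUrban2014.realPeriodRat_eq_unit_mul_plusPeriod_of_mazur hM)
    (SkinnerUrban2014.realPeriodRat_eq_unit_mul_plusPeriod_three_of_mazur hM) hmodP hfine

/-- **The A5 class leaf `BSDpOnClassX10b` modulo F1, the published binders and the rank-`1` Schneider rider — `hA`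
discharged** (`bsdpOnClassX10b_of_fine` with Greenberg's analytic `μ₃ = 0` supplied by the tree).  CONDITIONAL on the
displayed facts and `hC3`; nothing booked; BSD is not proved by this.
[cite: YanZhu2024MainConjNonCM, Thm. 4.9 (§4.4)] [cite: GreenbergLNM1716, Thm. 4.1 (p. 102) and §1 Conj. 1.11]
[cite: Kato2004Asterisque, Thm. 12.6 (p. 222) and §17.13 (pp. 279–280)] [cite: Miller2011LMS, §1 and Def. 1.1] -/
theorem bsdpOnClassX10b_of_fine'
    (hYZ : YanZhu2026.thm49_charIdeal_eq_padicLFunction)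
    (h5 : realPeriodRat_eq_unit_mul_plusPeriod) (h3 : realPeriodRat_eq_unit_mul_plusPeriod_three)
    (hS : Schneider1985_order_charGenerator_odd) (hPR : perrinRiou_rankOne_leadingTerms_odd)
    (hmodP : nonempty_modularParametrizationData)
    (hGZK : rank_eq_analyticRank_of_analyticRank_le_one)
    (hfine : exists_divisibilityInputs_fineQuotient_zeta)
    (hC3 : ∀ (W : WeierstrassCurve ℚ) [W.IsElliptic] [W.IsGloballyMinimal] (p : ℕ) [Fact p.Prime],
      ClassX10 W p → ¬ Surj W 3 → W.analyticRank = 1 →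
        ∀ Dh : PAdicHeightData W p, Dh.IsCanonical → SchneiderConjecture Dh) :
    BSDpOnClassX10b :=
  bsdpOnClassX10b_of_fine hYZ h5 h3 hS hPR hmodP hGZK hfine analyticMuZeroOnClassX10b_holds hC3

/-- **The A5 class leaf with the period-unit binders sourced to Mazur 1978 Cor. 4.1 — `hA` discharged**
(`bsdpOnClassX10b_of_fine_of_mazur` with Greenberg's analytic `μ₃ = 0` supplied by the tree).  CONDITIONAL on the
displayed facts and `hC3`; nothing booked; BSD is not proved by this.
[cite: Mazur1978, Cor. 4.1] [cite: YanZhu2024MainConjNonCM, Thm. 4.9 (§4.4)] [cite: GreenbergLNM1716, Thm. 4.1 (p. 102)]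
[cite: Miller2011LMS, §1 and Def. 1.1] -/
theorem bsdpOnClassX10b_of_fine_of_mazur'
    (hYZ : YanZhu2026.thm49_charIdeal_eq_padicLFunction) (hM : mazur_not_dvd_maninConstant_of_odd)
    (hS : Schneider1985_order_charGenerator_odd) (hPR : perrinRiou_rankOne_leadingTerms_odd)
    (hmodP : nonempty_modularParametrizationData)
    (hGZK : rank_eq_analyticRank_of_analyticRank_le_one)
    (hfine : exists_divisibilityInputs_fineQuotient_zeta)
    (hC3 : ∀ (W : WeierstrassCurve ℚ) [W.IsElliptic] [W.IsGloballyMinimal] (p : ℕ) [Fact p.Prime],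
      ClassX10 W p → ¬ Surj W 3 → W.analyticRank = 1 →
        ∀ Dh : PAdicHeightData W p, Dh.IsCanonical → SchneiderConjecture Dh) :
    BSDpOnClassX10b :=
  bsdpOnClassX10b_of_fine_of_mazur hYZ hM hS hPR hmodP hGZK hfine analyticMuZeroOnClassX10b_holds hC3

end Summit.BirchSwinnertonDyer.Rank1Residual.X10

/-! ### §4 The Howard/Heegner road to the leaf with `hA` discharged -/

namespace Summit.BirchSwinnertonDyer.Rank1Residual

open NumberField
open Literature.NumberTheory.EllipticCurves.BurungaleCastellaSkinner2025
  Literature.NumberTheory.EllipticCurves.JetchevSkinnerWan2017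
  Literature.NumberTheory.EllipticCurves.YanZhu2026
  Summit.BirchSwinnertonDyer.BirchSwinnertonDyer.Rank1Residual

/-- **`X10.BSDpOnClassX10b` ⟸ the FRAME SUPPLY `hFS₃` ∧ PUBLISHED facts — `hA` discharged** (§3 of
`LeafDischargeX10bHoward`, `X10.bsdpOnClassX10b_of_heegnerFrameSupply_of_cor46_of_fine`, with Greenberg's analytic
`μ = 0` at `3` on the class now the tree theorem `X10.analyticMuZeroOnClassX10b_holds`).  Binders = {`h46`, `hYZ`} ∪ the
sub-lists of `HeegnerPrintFactsX10b` / `PrintFactsX10b` ∪ {`hFS₃`}.  CONDITIONAL; nothing booked; no route file imported;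
BSD is not proved by this. [cite: MastellaZerman2026, Assumption 2.1 and Cor. 4.6]
[cite: YanZhu2024MainConjNonCM, Thm. 4.9, Thm. 5.7 (1), Thm. 5.9] [cite: Kato2004Asterisque, Thm. 12.5, Thm. 12.6 and §17.13]
[cite: GreenbergLNM1716, Thm. 4.1 and §1 Conj. 1.11] [cite: Mazur1978, Cor. 4.1] [cite: Miller2011LMS, §1 and Def. 1.1] -/
theorem X10.bsdpOnClassX10b_of_heegnerFrameSupply_of_cor46_of_fine'
    (h46 : MastellaZerman2026.cor46_howardDivisibility_of_scalarImage.{0})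
    (hYZ : thm57_thm59_bcs422_cgls513_generator_constantCoeff_of_heegnerDivisibility)
    (hGZ : ∀ (N : ℕ) [NeZero N] (W : WeierstrassCurve ℚ) (K : Type) [Field K] [NumberField K],
      gross_zagier N W K)
    (hKo : ∀ (N : ℕ) [NeZero N] (W : WeierstrassCurve ℚ) (K : Type) [Field K] [NumberField K],
      kolyvagin N W K)
    (h331 : thm331_anticyclotomicControl) (hmod : hasEntireLFunction_rat) (hnf : exists_isNewformOf)
    (hNS : integral_neronScaling_of_isGloballyMinimal)
    (hCM : bsdTriple_of_hasCM_of_L_one_ne_zero) (hLLT : LiLiuTian2024.thm11_bsdp_of_cm_rank_one)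
    (hKob : Kobayashi2013.cor14_bsdp_of_cm_rank_one)
    (hYZ49 : thm49_charIdeal_eq_padicLFunction) (hM : mazur_not_dvd_maninConstant_of_odd)
    (hS : Schneider1985_order_charGenerator_odd) (hmodP : nonempty_modularParametrizationData)
    (hGZK : rank_eq_analyticRank_of_analyticRank_le_one)
    (hfine : Kato2004.exists_divisibilityInputs_fineQuotient_zeta)
    (hFS₃ : ∀ (W : WeierstrassCurve ℚ) [W.IsElliptic] [W.IsGloballyMinimal] [NeZero (W.conductorNorm ℤ)]
      (p : ℕ) [Fact p.Prime], ClassX10 W p → ¬ Surj W 3 → ¬ W.HasCM → W.analyticRank = 1 →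
      ∃ (K : Type) (_ : Field K) (_ : NumberField K), IsImaginaryQuadratic K ∧
        Odd (NumberField.discr K) ∧ NumberField.discr K < -4 ∧
        SatisfiesHeegnerHypothesis (W.conductorNorm ℤ) K ∧ SatisfiesHeegnerHypothesis p K ∧
        ¬ p ∣ NumberField.classNumber K ∧
        (W.quadraticTwist (NumberField.discr K : ℚ)).entireLFunction 1 ≠ 0) :
    X10.BSDpOnClassX10b :=
  X10.bsdpOnClassX10b_of_heegnerFrameSupply_of_cor46_of_fine h46 hYZ hGZ hKo h331 hmod hnf hNS hCM hLLT hKob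
    hYZ49 hM hS hmodP hGZK hfine hFS₃ X10.analyticMuZeroOnClassX10b_holds

end Summit.BirchSwinnertonDyer.Rank1Residual

end
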